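import Summits.KontsevichZagierPeriods.KontsevichZagierPeriods.Theses.LinRedNormalForm
import Literature.NumberTheory.Transcendental.KZCalculusProofs
import Literature.NumberTheory.Transcendental.MZVSimplexRep
import Literature.NumberTheory.Transcendental.MZVSimplexRepProofs
import Literature.NumberTheory.Transcendental.MultipleZetaValuesProofs
import Literature.NumberTheory.Transcendental.LindemannWeierstrassProofs

/-!
# `DihedralNormalForm` (stmt-KontsevichZagierPeriods-3912): negative side — the sandwich, and tightness of Brown's weight bound

Landed copy of §0–§2 of the crux work file `Cruxes/DihedralNormalForm/Disproof.lean` (cdisprove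
seats, generations 1–3) for the crux `DihedralNormalForm` of route `LinRedNormalForm`: every
absolutely convergent genus-zero representation `[Δ_k, P/(∏ tᵢ^{bᵢ} ∏ (1-tᵢ)^{cᵢ}
∏_{i<j} (tᵢ-tⱼ)^{aᵢⱼ})]` is congruent modulo `KZ.relations` to a `ℤ`-combination of MZV word
representations `[Δ_w, q · ∏ ω_{εᵢ}(tᵢ)]`.  Nothing here refutes the crux; the file records, as
theorems other seats can import:

* §0 the hypothesis (`IsGenusZero`), the target (`wordRepSet`), the read-back `crux_iff`;
* §1 the SANDWICH: `valueLevel_of_crux` (crux ⇒ its value-level shadow `ValueLevel`, which is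
  Brown's theorem [Brown, Ann. ENS 2009, Thm 1.1] in this typing, by soundness) and
  `crux_of_summit_of_valueLevel` (summit ∧ value level ⇒ crux). Modulo Brown's printed theorem the
  crux is EQUIVALENT to Conjecture 1 on the pairs (genus-zero representation, word combination): a
  refutation of the crux refutes the summit and needs an additive invariant of `KZ.relations`
  finer than `KZ.eval`; no value-level counterexample exists;
* §2 TIGHTNESS of the weight bound: the strengthening "words of length `< k` suffice"
  (`CruxWeightBelow`) is false at `k = 2` (`not_cruxWeightBelow`: `[Δ₂, 1/(t₀(1-t₁))]` has value
  `π²/6`, words of length `0` evaluate in `ℚ`, words of length `1` have value `0` since the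
  letters are not integrable; transcendence of `π`). Any proof must produce words of length `k`.

Companion: `LoadBearing.lean` (rules (3) and (2) are load-bearing).
Sources: M. Kontsevich, D. Zagier, *Periods* (2001), §§1.1–1.2; F. Brown, *Multiple zeta values
and periods of moduli spaces*, Ann. Sci. ÉNS 42 (2009), Thm 1.1. -/

noncomputable section

open MeasureTheory Set
open Literature.NumberTheory.Transcendental

namespace Summit.KontsevichZagierPeriods.DihedralNormalForm.Negative

open Summit.KontsevichZagierPeriods.KontsevichZagierPeriods.Theses.LinRedNormalForm
  (DihedralNormalForm)

/-! ## §0 The crux, its hypothesis and its target set, named -/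

/-- The open ordered simplex `{1 > t₀ > ⋯ > t_{k-1} > 0}` exactly as inlined in the route file
(definitionally `KZ.openOrderedSimplex k`). -/
def simplex (k : ℕ) : Set (Fin k → ℝ) := {t | (∀ i, 0 < t i) ∧ (∀ i, t i < 1) ∧ StrictAnti t}

/-- The genus-zero integrand of the crux, as inlined in the route file. -/
def gzIntegrand (k : ℕ) (p : MvPolynomial (Fin k) ℚ) (a : Fin k → Fin k → ℕ) (b c : Fin k → ℕ)
    (t : Fin k → ℝ) : ℝ :=
  MvPolynomial.aeval t p / ((∏ i, t i ^ b i) * (∏ i, (1 - t i) ^ c i) *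
    ∏ i, ∏ j, if i < j then (t i - t j) ^ a i j else 1)

/-- Hypothesis of the crux on a representation `r`: genus-zero shape on the open simplex. -/
def IsGenusZero {k : ℕ} (r : KZ.IntegralRep k) : Prop :=
  ∃ (p : MvPolynomial (Fin k) ℚ) (a : Fin k → Fin k → ℕ) (b c : Fin k → ℕ),
    r.domain = simplex k ∧ EqOn r.integrand (gzIntegrand k p a b c) r.domain

/-- The MZV word representations (generators of the target subgroup of the crux). -/
def wordRepSet : Set KZ.FormalRep :=
  {x | ∃ (w : ℕ) (ε : Fin w → Bool) (q : ℚ) (s : KZ.IntegralRep w),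
    s.domain = simplex w ∧
    EqOn s.integrand (fun t => (q : ℝ) * ∏ i, if ε i then 1 / (1 - t i) else 1 / t i) s.domain ∧
    x = KZ.of s}

/-- The VALUES of the MZV word representations. -/
def wordValueSet : Set ℝ :=
  {x | ∃ (w : ℕ) (ε : Fin w → Bool) (q : ℚ) (s : KZ.IntegralRep w),
    s.domain = simplex w ∧
    EqOn s.integrand (fun t => (q : ℝ) * ∏ i, if ε i then 1 / (1 - t i) else 1 / t i) s.domain ∧
    x = s.value}

/-- The crux, restated through the names above (definitionally the route decl). -/
theorem crux_iff :
    DihedralNormalForm ↔ ∀ (k : ℕ) (r : KZ.IntegralRep k), IsGenusZero r →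
      ∃ m ∈ AddSubgroup.closure wordRepSet, KZ.of r - m ∈ KZ.relations := by
  constructor
  · intro h k r ⟨p, a, b, c, hdom, hint⟩
    exact h k r p a b c hdom hint
  · intro h k r p a b c hdom hint
    exact h k r ⟨p, a, b, c, hdom, hint⟩

/-! ## §1 The sandwich: crux ⇒ value level; summit ∧ value level ⇒ crux -/

/-- **Value-level shadow of the crux** (Brown's theorem in this typing, (Brown, Ann. ENS 2009, Thm 1.1):
the value of every absolutely convergent genus-zero representation lies in the subgroup of `ℝ`
generated by the values `q·ζ(ε)` of the MZV word representations, i.e. in the `ℚ`-span of the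
MZVs and `1`). NOT proved in the tree; it is the printed theorem. -/
def ValueLevel : Prop :=
  ∀ (k : ℕ) (r : KZ.IntegralRep k), IsGenusZero r → r.value ∈ AddSubgroup.closure wordValueSet

/-- Soundness transports the target subgroup onto its values. -/
theorem eval_mem_closure_wordValueSet {m : KZ.FormalRep} (hm : m ∈ AddSubgroup.closure wordRepSet) :
    KZ.eval m ∈ AddSubgroup.closure wordValueSet := by
  induction hm using AddSubgroup.closure_induction with
  | mem x hx =>
    obtain ⟨w, ε, q, s, hdom, hint, rfl⟩ := hx
    refine AddSubgroup.subset_closure ⟨w, ε, q, s, hdom, hint, ?_⟩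
    simp
  | zero => simp
  | add x y _ _ hx hy => simpa using add_mem hx hy
  | neg x _ hx => simpa using neg_mem hx

/-- **Crux ⇒ value level** (soundness `KZ.relations_le_ker_eval_holds`). Hence a value-level
counterexample to the crux would contradict Brown's printed theorem: none exists. -/
theorem valueLevel_of_crux (h : DihedralNormalForm) : ValueLevel := by
  intro k r hr
  obtain ⟨m, hm, hrel⟩ := (crux_iff.1 h) k r hr
  have h0 : KZ.eval (KZ.of r - m) = 0 :=
    (AddMonoidHom.mem_ker).1 (KZ.relations_le_ker_eval_holds hrel)
  rw [map_sub, KZ.eval_of, sub_eq_zero] at h0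
  rw [h0]
  exact eval_mem_closure_wordValueSet hm

/-- Every element of the value subgroup is the evaluation of a formal combination of word
representations. -/
theorem exists_eval_eq_of_mem_closure_wordValueSet {x : ℝ}
    (hx : x ∈ AddSubgroup.closure wordValueSet) :
    ∃ m ∈ AddSubgroup.closure wordRepSet, KZ.eval m = x := by
  induction hx using AddSubgroup.closure_induction with
  | mem x hx =>
    obtain ⟨w, ε, q, s, hdom, hint, rfl⟩ := hx
    exact ⟨KZ.of s, AddSubgroup.subset_closure ⟨w, ε, q, s, hdom, hint, rfl⟩, by simp⟩
  | zero => exact ⟨0, zero_mem _, by simp⟩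
  | add x y _ _ hx hy =>
    obtain ⟨m, hm, rfl⟩ := hx
    obtain ⟨m', hm', rfl⟩ := hy
    exact ⟨m + m', add_mem hm hm', by simp⟩
  | neg x _ hx =>
    obtain ⟨m, hm, rfl⟩ := hx
    exact ⟨-m, neg_mem hm, by simp⟩

/-- **Summit ∧ value level ⇒ crux.** Given Brown's theorem, the crux FOLLOWS from Conjecture 1:
write `[r] − m ≡ [r₁] − [r₂]` modulo relations (`KZ.exists_integralRep_sub_holds`), rationalise
`rᵢ` (`KZ.exists_isRational_equivalent_holds`), and apply the summit to the rational pair, whose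
values agree by soundness. With `valueLevel_of_crux`: modulo Brown's printed theorem the crux is
EQUIVALENT to Conjecture 1 on the pairs (genus-zero rep, combination of word reps); a kill of the
crux is a kill of the summit. -/
theorem crux_of_summit_of_valueLevel (hS : KontsevichZagierPeriods) (hV : ValueLevel) :
    DihedralNormalForm := by
  rw [crux_iff]
  intro k r hr
  obtain ⟨m, hm, hval⟩ := exists_eval_eq_of_mem_closure_wordValueSet (hV k r hr)
  refine ⟨m, hm, ?_⟩
  set c : KZ.FormalRep := KZ.of r - m with hc
  have hc0 : KZ.eval c = 0 := by simp [hc, hval]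
  obtain ⟨n₁, n₂, r₁, r₂, hsub⟩ := KZ.exists_integralRep_sub_holds c
  obtain ⟨m₁, r₁', hrat₁, heq₁⟩ := KZ.exists_isRational_equivalent_holds r₁
  obtain ⟨m₂, r₂', hrat₂, heq₂⟩ := KZ.exists_isRational_equivalent_holds r₂
  have hsound : ∀ x ∈ KZ.relations, KZ.eval x = 0 := fun x hx =>
    (AddMonoidHom.mem_ker).1 (KZ.relations_le_ker_eval_holds hx)
  have hv : r₁'.value = r₂'.value := by
    have h1 := hsound _ hsub
    have h2 := hsound _ heq₁
    have h3 := hsound _ heq₂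
    simp only [map_sub, KZ.eval_of, hc0] at h1 h2 h3
    linarith
  have hE : KZ.Equivalent r₁' r₂' := hS r₁' r₂' hrat₁ hrat₂ hv
  -- [r₁] − [r₂] = ([r₁] − [r₁']) + ([r₁'] − [r₂']) − ([r₂] − [r₂'])
  have h12 : KZ.of r₁ - KZ.of r₂ ∈ KZ.relations := by
    have key := sub_mem (add_mem heq₁ hE) heq₂
    have : KZ.of r₁ - KZ.of r₁' + (KZ.of r₁' - KZ.of r₂') - (KZ.of r₂ - KZ.of r₂') =
        KZ.of r₁ - KZ.of r₂ := by abel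
    simpa [KZ.Equivalent, this] using key
  have key := add_mem hsub h12
  rwa [sub_add_cancel] at key

/-- The two directions together: under Conjecture 1 the crux is exactly its value-level shadow. -/
theorem crux_iff_valueLevel_of_summit (hS : KontsevichZagierPeriods) :
    DihedralNormalForm ↔ ValueLevel :=
  ⟨valueLevel_of_crux, crux_of_summit_of_valueLevel hS⟩


/-! ## §2 Tightness of Brown's weight bound: words of length `< k` do not suffice

Brown's theorem bounds the weights of the MZVs by the dimension `k`; the crux allows every word
length `w` (only admissible words converge).  The natural strengthening "words of length `< k`"
is false already at `k = 2`: the genus-zero representation `[Δ₂, 1/(t₀(1-t₁))]` (Kontsevich's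
formula for `ζ(2)`, `KZ.mzvRep [2]`) has value `π²/6`, while a word representation of length `0`
has a rational value and a word representation of length `1` with `q ≠ 0` does not exist (the
letters `1/t`, `1/(1-t)` are not integrable on `(0,1)`), so everything reachable evaluates in `ℚ`.
Complements generation 1's `not_dihedralNormalFormHomogeneous` (length exactly `k` fails): the
normal form must mix weights `0, …, k` and must reach `k`. -/

/-- The representation `[Δ₂, 1/(t₀(1-t₁))]` of `ζ(2)` (Kontsevich's formula; `KZ.mzvRep [2]` with
its two analytic inputs discharged in the tree). (Kontsevich–Zagier 2001, §1.1) -/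
def zeta2Rep : KZ.IntegralRep 2 :=
  KZ.mzvRep [2] MZV.isAdmissible_two (KZ.mzvIntegrand_isSemialgebraicFunOn_holds [2])
    (KZ.mzvIntegrand_integrableOn_holds [2] MZV.isAdmissible_two)

/-- The domain of the `ζ(2)` representation is `Δ₂`. -/
theorem zeta2Rep_domain : zeta2Rep.domain = simplex 2 := rfl

/-- The integrand of the `ζ(2)` representation is `1/(t₀(1-t₁))`. -/
theorem zeta2Rep_integrand (t : Fin 2 → ℝ) :
    zeta2Rep.integrand t = 1 / t 0 * (1 / (1 - t 1)) := by
  show (∏ i : Fin 2, KZ.mzvForm ((MZV.binaryWord [2]).getD i false) (t i)) = _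
  simp [KZ.mzvForm, MZV.binaryWord, Fin.prod_univ_two]

/-- `value [Δ₂, 1/(t₀(1-t₁))] = ζ(2) = π²/6`. [Euler; Kontsevich–Zagier 2001, §1.1] -/
theorem zeta2Rep_value : zeta2Rep.value = Real.pi ^ 2 / 6 := by
  rw [← multipleZeta_two]
  exact KZ.mzvRep_value_holds [2] MZV.isAdmissible_two _ _

/-- `[Δ₂, 1/(t₀(1-t₁))]` has the genus-zero shape of the crux (`P = 1`, `b = (1,0)`, `c = (0,1)`,
`a = 0`): the hypotheses of the crux are satisfiable by a representation with irrational value. -/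
theorem isGenusZero_zeta2Rep : IsGenusZero zeta2Rep := by
  refine ⟨1, fun _ _ => 0, ![1, 0], ![0, 1], rfl, ?_⟩
  intro t ht
  rw [zeta2Rep_integrand]
  simp [gzIntegrand, Fin.prod_univ_two, mul_comm]

/-- `Δ₁` is the open unit interval. -/
theorem simplex_one : simplex 1 = {t | 0 < t 0 ∧ t 0 < 1} := by
  ext t
  simp only [simplex, mem_setOf_eq, Fin.forall_fin_one]
  constructor
  · rintro ⟨h0, h1, -⟩; exact ⟨h0, h1⟩
  · rintro ⟨h0, h1⟩; exact ⟨h0, h1, Subsingleton.strictAnti t⟩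

/-- A word representation of length `0` evaluates to its rational coefficient `q`. -/
theorem value_word_zero {ε : Fin 0 → Bool} {q : ℚ} {s : KZ.IntegralRep 0}
    (hdom : s.domain = simplex 0)
    (hint : EqOn s.integrand (fun t => (q : ℝ) * ∏ i, if ε i then 1 / (1 - t i) else 1 / t i)
      s.domain) :
    s.value = q := by
  have volume_univ_fin_zero : volume (univ : Set (Fin 0 → ℝ)) = 1 := by
    rw [volume_pi, Measure.pi_univ]; simp
  have simplex_zero : simplex 0 = univ := by
    ext t
    simp only [simplex, mem_setOf_eq, mem_univ, iff_true]
    exact ⟨fun i => i.elim0, fun i => i.elim0, fun i => i.elim0⟩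
  have hfun : s.integrand = fun _ => (q : ℝ) := by
    funext t
    have := hint (show t ∈ s.domain by rw [hdom, simplex_zero]; trivial)
    simpa using this
  rw [KZ.IntegralRep.value, hdom, simplex_zero, Measure.restrict_univ, hfun, integral_const,
    measureReal_def, volume_univ_fin_zero]
  simp

/-- The letters `1/t` and `1/(1 - t)` are not integrable on `(0, 1)`: there is no convergent word
representation of length `1` with `q ≠ 0`. -/
theorem not_integrableOn_letter (ε : Bool) :
    ¬ IntegrableOn (fun t : Fin 1 → ℝ => if ε then 1 / (1 - t 0) else 1 / t 0) (simplex 1) := by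
  intro h
  set e : (Fin 1 → ℝ) ≃ᵐ ℝ := MeasurableEquiv.funUnique (Fin 1) ℝ with he
  have hmap : Measure.map e volume = volume := (volume_preserving_funUnique (Fin 1) ℝ).map_eq
  have hpre : e ⁻¹' Ioo (0 : ℝ) 1 = simplex 1 := by
    rw [simplex_one]; ext t; simp [he, MeasurableEquiv.funUnique]
  have key : IntegrableOn (fun x : ℝ => if ε then 1 / (1 - x) else 1 / x) (Ioo 0 1) volume := by
    rw [← hmap, integrableOn_map_equiv e, hpre]
    refine h.congr_fun (fun t _ => ?_) (by rw [← hpre]; exact measurableSet_Ioo.preimage e.measurable)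
    simp [he, MeasurableEquiv.funUnique]
  have hI : IntervalIntegrable (fun x : ℝ => if ε then 1 / (1 - x) else 1 / x) volume 0 1 :=
    (intervalIntegrable_iff_integrableOn_Ioo_of_le zero_le_one).2 key
  cases ε with
  | false =>
    have h' : IntervalIntegrable (fun x : ℝ => x⁻¹) volume 0 1 :=
      hI.congr (by intro x _; simp)
    rw [intervalIntegrable_inv_iff] at h'
    rcases h' with h' | h'
    · exact zero_ne_one h'
    · exact h' (by simp)
  | true =>
    have h' : IntervalIntegrable (fun x : ℝ => (x - 1)⁻¹) volume 0 1 := by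
      refine (hI.neg).congr ?_
      intro x _
      simp only [Pi.neg_apply, if_true, one_div]
      rw [← inv_neg, neg_sub]
    rw [intervalIntegrable_sub_inv_iff] at h'
    rcases h' with h' | h'
    · exact zero_ne_one h'
    · exact h' (by simp)

/-- A word representation of length `1` has `q = 0`, hence value `0`. -/
theorem value_word_one {ε : Fin 1 → Bool} {q : ℚ} {s : KZ.IntegralRep 1}
    (hdom : s.domain = simplex 1)
    (hint : EqOn s.integrand (fun t => (q : ℝ) * ∏ i, if ε i then 1 / (1 - t i) else 1 / t i)
      s.domain) :
    s.value = 0 := by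
  by_cases hq : q = 0
  · rw [KZ.IntegralRep.value]
    refine (setIntegral_congr_fun (KZ.IntegralRep.measurableSet_domain_holds s) hint).trans ?_
    simp [hq]
  · exfalso
    apply not_integrableOn_letter (ε 0)
    have h1 : IntegrableOn (fun t => (q : ℝ) * ∏ i, if ε i then 1 / (1 - t i) else 1 / t i)
        (simplex 1) := hdom ▸ s.integrableOn.congr_fun hint (KZ.IntegralRep.measurableSet_domain_holds s)
    have h2 : IntegrableOn (fun t => (q : ℝ)⁻¹ * ((q : ℝ) * ∏ i, if ε i then 1 / (1 - t i) else 1 / t i))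
        (simplex 1) := h1.const_mul _
    refine IntegrableOn.congr_fun h2 (fun t _ => ?_) (hdom ▸ KZ.IntegralRep.measurableSet_domain_holds s)
    have hq' : (q : ℝ) ≠ 0 := by exact_mod_cast hq
    simp [← mul_assoc, inv_mul_cancel₀ hq']

/-- **The strengthening of the crux to words of length `< k`.** -/
def CruxWeightBelow : Prop :=
  ∀ (k : ℕ) (r : KZ.IntegralRep k), IsGenusZero r →
    ∃ m ∈ AddSubgroup.closure {x : KZ.FormalRep | ∃ (w : ℕ) (_ : w < k) (ε : Fin w → Bool) (q : ℚ)
        (s : KZ.IntegralRep w), s.domain = simplex w ∧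
        EqOn s.integrand (fun t => (q : ℝ) * ∏ i, if ε i then 1 / (1 - t i) else 1 / t i)
          s.domain ∧ x = KZ.of s},
      KZ.of r - m ∈ KZ.relations

/-- Everything reachable from words of length `< 2` evaluates in `ℚ`. [folklore] -/
theorem eval_rational_of_mem_closure_lt_two {m : KZ.FormalRep}
    (hm : m ∈ AddSubgroup.closure {x : KZ.FormalRep | ∃ (w : ℕ) (_ : w < 2) (ε : Fin w → Bool)
        (q : ℚ) (s : KZ.IntegralRep w), s.domain = simplex w ∧
        EqOn s.integrand (fun t => (q : ℝ) * ∏ i, if ε i then 1 / (1 - t i) else 1 / t i)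
          s.domain ∧ x = KZ.of s}) :
    ∃ q : ℚ, KZ.eval m = q := by
  induction hm using AddSubgroup.closure_induction with
  | mem x hx =>
    obtain ⟨w, hw, ε, q, s, hdom, hint, rfl⟩ := hx
    rw [KZ.eval_of]
    interval_cases w
    · exact ⟨q, value_word_zero hdom hint⟩
    · exact ⟨0, by simpa using value_word_one hdom hint⟩
  | zero => exact ⟨0, by simp⟩
  | add x y _ _ hx hy =>
    obtain ⟨a, ha⟩ := hx; obtain ⟨b, hb⟩ := hy
    exact ⟨a + b, by simp [ha, hb]⟩
  | neg x _ hx =>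
    obtain ⟨a, ha⟩ := hx
    exact ⟨-a, by simp [ha]⟩

/-- **Tightness of the weight bound (refuted strengthening).** The crux with word lengths
restricted to `w < k` is FALSE: at `k = 2` the representation `[Δ₂, 1/(t₀(1-t₁))]` would be
congruent to a combination evaluating in `ℚ`, so `π² / 6 ∈ ℚ` by soundness, contradicting the
transcendence of `π` (`transcendental_pi_holds`, Lindemann). Any proof of the crux must produce
words of the top length `k` (at `k = 2`: the word `01` itself). [folklore] -/
theorem not_cruxWeightBelow : ¬ CruxWeightBelow := by
  intro h
  obtain ⟨m, hm, hrel⟩ := h 2 zeta2Rep isGenusZero_zeta2Rep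
  obtain ⟨q, hq⟩ := eval_rational_of_mem_closure_lt_two hm
  have h0 : KZ.eval (KZ.of zeta2Rep - m) = 0 :=
    (AddMonoidHom.mem_ker).1 (KZ.relations_le_ker_eval_holds hrel)
  rw [map_sub, KZ.eval_of, sub_eq_zero, zeta2Rep_value, hq] at h0
  -- π is a root of X² − 6q
  apply transcendental_pi_holds
  refine ⟨Polynomial.X ^ 2 - Polynomial.C (6 * q), ?_, ?_⟩
  · intro hz
    have := congrArg (Polynomial.coeff · 2) hz
    simp [Polynomial.coeff_X_pow] at this
  · simp only [map_sub, map_pow, Polynomial.aeval_X, Polynomial.aeval_C, eq_ratCast,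
      Rat.cast_mul, Rat.cast_ofNat]
    linarith


end Summit.KontsevichZagierPeriods.DihedralNormalForm.Negative
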